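import Literature.NumberTheory.Sieve.MaynardTaoL2Reduction
import Literature.NumberTheory.Sieve.VaughanMeanValue
import HarnessLib

/-!
# Maynard–Tao (`p_{n+m} − p_n ≪ m³ e^{4m}`): what the theorem still rests on

J. Maynard, *Small gaps between primes*, Ann. of Math. (2) 181 (2015), 383–413 = arXiv:1311.4600,
Theorem 1.1, vendored as the named fact `Literature.NumberTheory.Sieve.frequently_nth_prime_add_le_maynard_tao`
(`ParityWave0.lean`). Its printed proof (§4) combines the Bombieri–Vinogradov theorem (level of
distribution `θ = 1/2 − ε`), Prop. 4.2 (the sieve: Prop. 4.1 = Lemmas 5.1–6.3) and Prop. 4.3(3)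
(`M_k > log k − 2 log log k − 2`, §7). In the tree:

* Prop. 4.3(3) is PROVED (`exists_maynardFunctional_gt_holds`, `MaynardTaoLargeKProofs.lean`);
* the assembly of Theorem 1.1 from the three inputs is PROVED (`ParityWave0MaynardTaoProofs.lean`);
* the general Prop. 4.2 (square-integrable `F`) is reduced to its `C¹` form
  (`frequently_card_primes_ge_of_maynardFunctional_of_smooth`, `MaynardTaoL2Reduction.lean`);
* Bombieri–Vinogradov is reduced to the Siegel–Walfisz theorem
  (`Parity.bombieri_vinogradov_of_siegelWalfisz`, `VaughanMeanValue.lean`, Vaughan's identity and the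
  large sieve being proved there and in `BombieriVinogradovReduction.lean`).

Hence (`frequently_nth_prime_add_le_maynard_tao_of_siegelWalfisz_of_smooth`, this file) Maynard's
Theorem 1.1 rests on exactly two named facts: `Parity.siegel_walfisz` (parity.S28) and
`frequently_card_primes_ge_of_maynardFunctional_smooth` (Maynard's Prop. 4.2 for `F = G · 1_{R_k}`,
`G ∈ C¹`; itself reduced in `MaynardSieve.lean`/`MaynardSieveS1.lean`/`MaynardSieveLemma51.lean` to
Lemma 6.2's smooth sum `maynard_lemma62_sum` and the `S₂` asymptotic `maynard_S2_asymptotic`).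

## References

* J. Maynard, *Small gaps between primes*, Ann. of Math. (2) 181 (2015), 383–413,
  doi:10.4007/annals.2015.181.1.7 = arXiv:1311.4600; Theorem 1.1 and §4. [cite: MaynardAnnals2015]
* R. C. Vaughan, *An elementary method in prime number theory*, Acta Arith. 37 (1980), 111–115,
  Theorem 3. [cite: Vaughan1980]
-/

namespace Literature.NumberTheory.Sieve

/-- **Maynard 2015, Theorem 1.1 from Siegel–Walfisz and the smooth Prop. 4.2**:
`siegel_walfisz` ⟹ Bombieri–Vinogradov (`Parity.bombieri_vinogradov_of_siegelWalfisz`) ⟹ level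
`1/2 − ε`; the smooth Prop. 4.2 ⟹ the general one (`frequently_card_primes_ge_of_maynardFunctional_of_smooth`);
with Prop. 4.3(3) (`exists_maynardFunctional_gt_holds`) the §4 assembly
(`Parity.frequently_nth_prime_add_le_maynard_tao_of_bombieri_vinogradov`) gives
`p_{n+m} − p_n ≪ m³ e^{4m}` infinitely often. [cite: MaynardAnnals2015, Theorem 1.1 and §4] -/
theorem frequently_nth_prime_add_le_maynard_tao_of_siegelWalfisz_of_smooth
    (hSW : Sieve.siegel_walfisz) (h42 : frequently_card_primes_ge_of_maynardFunctional_smooth) :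
    Sieve.frequently_nth_prime_add_le_maynard_tao :=
  Sieve.frequently_nth_prime_add_le_maynard_tao_of_bombieri_vinogradov
    (Sieve.bombieri_vinogradov_of_siegelWalfisz hSW) exists_maynardFunctional_gt_holds
    (frequently_card_primes_ge_of_maynardFunctional_of_smooth h42)

/-- The same with the smooth Prop. 4.2 split into Maynard's Prop. 4.1 halves (Lemmas 6.2, 6.3 =
`maynard_S1_asymptotic`, `maynard_S2_asymptotic`): Theorem 1.1 from Siegel–Walfisz and Prop. 4.1.
[cite: MaynardAnnals2015, Theorem 1.1, Prop. 4.1 and §4] -/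
theorem frequently_nth_prime_add_le_maynard_tao_of_siegelWalfisz_of_asymptotics
    (hSW : Sieve.siegel_walfisz) (hS1 : maynard_S1_asymptotic) (hS2 : maynard_S2_asymptotic) :
    Sieve.frequently_nth_prime_add_le_maynard_tao :=
  Sieve.frequently_nth_prime_add_le_maynard_tao_of_sieve_asymptotics
    (Sieve.bombieri_vinogradov_of_siegelWalfisz hSW) hS1 hS2

end Literature.NumberTheory.Sieve
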